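import Summits.QuantumFields.BalabanUV.T4Continuum.Support.ShellMeasureLandauEndAssembledDecayReachBox

/-!
# `T4Continuum.ShellMeasureLandauEndAssembledDecayReachBoxKept` — THE KEPT FORM of the most-assembled one-slot END of record:
# S80 f6 `…ReachBox.…_of_core_collar` with the conclusion for the RESTRICTED density `𝟙{u < εθη²}·F` (the slot's own
# small-field indicator KEPT), same binders, same constant — the export the HISTORIES ROAD (row S103b) consumes
(cell `pub-balaban`, sub-cell `t4`, spine estimate NE7c (node U5b); NE7c ROUND-2 crew, unit `b2b-balaban-t4-ne7c-formalise-leaf-03`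
gen 8; asked for by leaf-05-g10 A-ne7cL05g10-1 (journal l.20870, «DIRECTION CAVEAT») on the owner's candidate row S103
(Q-ne7cp1-g35-1 l.20681, booked S103a∕b R-ne7cp1-g35-6 l.20881); ADDITIVE — imports S80 f6 `ShellMeasureLandauEndAssembledDecayReachBox`
ONLY (this lineage), consumed BY NAME, plus — through its closure — S73 `ShellMeasureLandauHolonomyStokes`
(`hAN_landau_chartRay_stokes`, `hSM_of_stokes`), `ShellMeasureLandauPrinted` (`scheme_numbers_of_printed`, `sectC_numbers_of_printed`),
S87 f1 `ShellMeasureWindowRestrict` (`measurable_indicator_density`, `indicator_mul_invariant`,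
`slotAntiConcentration_withDensity_of_indicator`), S87 f2 `ShellMeasureLandauEndWindowRestrict` (`classifier_lt_of_contraction`,
`mem_cube_of_mem_closedBall`, `exp_neg_smul_mem_closedBall`); [folklore]; 0 `def`, 0 `def … : Prop`, 0 sorry, 0 citation tags)

HONEST FRAMING.  Finite four-torus programme, rung (B)+1 only — NOT infinite volume, NOT a mass gap, NOT the Clay problem, NOT
summit progress; NE7c (`T4IndicatorShell.ShellWeightBound`) NOT PRINTED in [Balaban 1983–89], NOT PROVED; «NE7c ⇐ the named
binders» (trigger c3); (M1) realized ≠ NE7c.  Nothing printed is asserted; no estimate of Bałaban's is discharged; a WRAPPER on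
OUR side — S80 f6 APPLIED BY NAME to the restricted density; NOTHING in the countdown moves; spine PROVED 0∕9.  HONEST DEPENDENCY
(cell): continuum YM on T⁴ ⇐ BetaPertH ∧ nine spine estimates (0/9 proved); BetaPertH ⇐ (D1) ∧ (D4) ∧ CAP+tail; G-an2-4 gates
asym, D1 and NE2/3/4.

THE POINT (leaf-05-g10, l.20870 (2)).  (M1) `SlotAntiConcentration μ u θ ρ D := μ{θ(1−ρ) ≤ u < θ} ≤ Dρ·μ(univ)` for
`μ = F·ν` (DROPPED form — what every END of record concludes) is WEAKER than for `μ = 𝟙{u<θ}F·ν` (KEPT form: the total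
mass is the sub-threshold mass only); S87 f1 `slotAntiConcentration_withDensity_of_indicator` goes KEPT → DROPPED, not back.
The histories road needs the KEPT form itself: a history's law is `histLaw ν sm u ϑ = ν.withDensity (smallProd …)` with the
slot's OWN indicator `χ_{ϑ s}(u_s)` among the factors (S24 `ShellMeasureRootCompositionHistories.partialLaw`, «own indicator
kept»).  S87 f2∕f2b PROVE the kept form — S76 f2 fired at `𝟙{u<θ}·F` with the co-test `Jco·𝟙{u∘section<θ}`, centre-monotone
because the classifier's sub-threshold set is STAR-SHAPED along the contraction (`classifier_lt_of_contraction` on S73's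
(AN-bound)) — but only as an intermediate, dropping the indicator on their last line; S80 f5∕f6 and S99 f3b inherit the
dropped conclusion.  THIS FILE exports the kept form AT THE LEVEL OF THE DECLARATION OF RECORD by a WRAPPER (no re-assembly):
* **`slotAC_realized_su2_landauChart_assembled_decay_of_core_collar_kept`** — S80 f6's binders VERBATIM (box, block, comb gauge,
  (T1)∕(T2)∕(T3)∕(S78), real structure, dictionary, co-test, window, (SM) in the Stokes currency, the γ3 PAIR + reach + cover);
  CONCLUSION `SlotAntiConcentration ((fieldMeasure P j SU2).withDensity ({U | u U < εθ·η²}.indicator F)) u (εθ·η²) ρ (f6's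
  constant)`.  Proof: S80 f6 APPLIED BY NAME to `F₁ := 𝟙{u<εθη²}·F` and `Jco₁ V := 𝟙{u∘section_V < εθη²}·Jco V` — every
  F-hypothesis of f6 re-derived for `F₁` from the one for `F` (`hF`∕`hFi` by S87 f1's lemmas, `hcollar` since `F₁ ≠ 0 ⟹ F ≠ 0`,
  `hRdict`∕`hJW`∕`hJ1` by cases on the indicator, `hJ` by `classifier_lt_of_contraction` on `hAN_landau_chartRay_stokes` of the
  (T1) data + `hSM_of_stokes` — the f2b argument, at the comb gauge `fixTo (combBonds lo hi) 1`, centre `1`);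
* the DROPPED form (= S80 f6's conclusion) comes back at any call site in ONE line, S87 f1
  `slotAntiConcentration_withDensity_of_indicator hu hθ hρ0` — the two hosts are interchangeable; S99 f3b's kept twin is its
  proof with `…_of_core_collar_kept` in its last line (leaf-07 lineage, if the owner books it for S103b).
NOTHING in the countdown moves; NE7c NOT PROVED; spine PROVED 0∕9.
-/

noncomputable section

open Set Metric NormedSpace MeasureTheory Function

namespace Summit.QuantumFields.BalabanUV.T4Continuum.ShellMeasureLandauEndAssembledDecayReachBoxKept

open scoped ENNReal
open Literature.MathematicalPhysics.QuantumFieldTheory.Balaban1983to89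
open B11Prop6Scheme (Prop4Hyp)
open GaugeField (GaugeInvariant)
open T4ShellMeasure (SlotAntiConcentration)
open T4CubePoincare (cube)
open T4CubeChartGnomonic (SU2)
open T4CubeChartExp (expFibreChart)
open T4TreeGaugeFixing (NoClosedLoop fixTo noClosedLoop_combBonds)
open T4ShellMeasurePlaquette (expTail₂)
open ShellMeasureLevelAssembly (classifier)
open ShellMeasureMultiGridNorms (WSup)
open ShellMeasurePinnedNorm (pinW)
open ShellMeasureLandauHolonomy (solAt landauExp)
open ShellMeasureLandauHolonomyChart (holOf cplx)
open ShellMeasureLandauHolonomySkew (readOutReal)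
open ShellMeasureDecayKernelSums (kerOp)
open T4AxialGaugeSmallField (boxPlaqs boxBonds)
open T4AxialGaugeFixing (combBonds)
open ShellMeasureLandauHolonomyStokes (hAN_landau_chartRay_stokes hSM_of_stokes)
open ShellMeasureLandauPrinted (scheme_numbers_of_printed sectC_numbers_of_printed)
open ShellMeasureWindowRestrict (measurable_indicator_density indicator_mul_invariant
  slotAntiConcentration_withDensity_of_indicator)
open ShellMeasureLandauEndWindowRestrict (classifier_lt_of_contraction mem_cube_of_mem_closedBall
  exp_neg_smul_mem_closedBall)
open ShellMeasureLandauEndAssembledDecayReachBox (slotAC_realized_su2_landauChart_assembled_decay_of_core_collar)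

section Kept

open scoped Matrix.Norms.L2Operator

variable {P : Params} {j : ℕ} [DecidableEq (PBond P j)]
variable {n : Type*} [Fintype n] [DecidableEq n] [Nonempty n]
variable {𝒴 𝒴' 𝒳 𝒵 ℬ : Type*} [NormedAddCommGroup 𝒴] [NormedSpace ℂ 𝒴] [CompleteSpace 𝒴]
  [NormedAddCommGroup 𝒴'] [NormedSpace ℂ 𝒴'] [NormedAddCommGroup 𝒳] [NormedSpace ℂ 𝒳] [CompleteSpace 𝒳]
  [NormedAddCommGroup 𝒵] [NormedSpace ℂ 𝒵] [NormedAddCommGroup ℬ] [NormedSpace ℂ ℬ]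

/-- **THE MOST-ASSEMBLED ONE-SLOT END OF RECORD, KEPT FORM.**  Binders = S80 f6
`ShellMeasureLandauEndAssembledDecayReachBox.slotAC_realized_su2_landauChart_assembled_decay_of_core_collar` VERBATIM; conclusion
= (M1) for the RESTRICTED density `𝟙{u < εθ·η²}·F` along `u` at `εθ·η²` with f6's slot constant (total mass = the slot's
sub-threshold mass).  Proof: f6 BY NAME for `F₁ := 𝟙{u<εθη²}·F`, `Jco₁ := 𝟙{u∘section<εθη²}·Jco`; the extra indicator is
centre-monotone because the classifier's sub-threshold set is star-shaped along the contraction (S87 f2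
`classifier_lt_of_contraction` on S73 `hAN_landau_chartRay_stokes` of the (T1) data + `hSM_of_stokes`).  CONDITIONAL on every
binder; readings NOT asserted; NOT Bałaban's minimiser; (M1) realized ≠ NE7c. [folklore] -/
theorem slotAC_realized_su2_landauChart_assembled_decay_of_core_collar_kept
    -- the BOX `[lo, hi]` (the block `□^{∼4}`: `nb` unit steps per direction, non-wrapping on the torus) and its axial comb
    {lo hi : Fin P.d → ℤ} {nb : ℕ} (hn : ∀ κ, hi κ ≤ lo κ + nb) (hN : ∀ κ, hi κ - lo κ < P.sitesPerDir j)
    (Λ : Finset (PBond P j)) (hΛbox : ∀ b ∈ Λ, b ∈ boxBonds lo hi) (hΛcomb : Disjoint Λ (combBonds lo hi))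
    {m₀ : ℕ} (e : ↥Λ × Fin 3 ≃ Fin m₀)
    {S : ℝ} (hS : 0 < S) (hSπ : 3 * S ^ 2 < Real.pi ^ 2)
    {F : GaugeField P j SU2 → ℝ≥0∞} (hF : Measurable F) (hFi : GaugeInvariant F)
    {u : GaugeField P j SU2 → ℝ} (hu : Measurable u) (hui : GaugeInvariant u)
    {ι : Type*} {Pu : Finset ι} (hPu : Pu.Nonempty)
    (W : GaugeField P j SU2 → Set (Fin m₀ → ℝ)) (Jco : GaugeField P j SU2 → (Fin m₀ → ℝ) → ℝ≥0∞)
    {δ ρ β : ℝ}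
    (𝒢 : GaugeField P j SU2 → (𝒵 →L[ℂ] 𝒴)) (W𝒱 : GaugeField P j SU2 → 𝒴 → 𝒵) {B₀ C₄ a₃ ε₄ : ℝ}
    (h𝒢 : ∀ V f, ‖𝒢 V f‖ ≤ B₀ * ‖f‖) (hW : ∀ V, Prop4Hyp (W𝒱 V) C₄ a₃) (hB₀ : 0 < B₀) (hC₄ : 0 ≤ C₄)
    (hε₄ : 0 ≤ ε₄)
    {dL C₁ B₃ ε₁ : ℝ} (hdL : 0 ≤ dL) (hC₁ : 0 ≤ C₁) (hε₁ : 0 ≤ ε₁) (hB₃ : dL ≤ B₃)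
    (h1 : 2 * B₀ * C₁ * B₃ * ε₁ ≤ ε₄) (h2 : 4 * ε₄ ≤ a₃) (h3 : 16 * B₀ * C₄ * ε₄ ≤ 1)
    (H₁ : GaugeField P j SU2 → (ℬ →L[ℂ] 𝒴)) (hH₁ : ∀ V B, ‖H₁ V B‖ ≤ B₀ * ‖B‖)
    (Φ : GaugeField P j SU2 → (Fin m₀ → ℂ) → ℬ) {rΦ : ℝ} (hΦd : ∀ V, DifferentiableOn ℂ (Φ V) (ball 0 rΦ))
    (hΦ0 : ∀ V, Φ V 0 = 0) (hΦ : ∀ V, ∀ z ∈ ball (0 : Fin m₀ → ℂ) rΦ, ‖Φ V z‖ < 2 * dL * C₁ * ε₁) (hSr : S < rΦ)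
    (Cf : GaugeField P j SU2 → 𝒴' → 𝒳) {C₂ RC : ℝ} (hC₂ : 0 ≤ C₂)
    (hCq : ∀ V, ∀ Z : 𝒴', ‖Z‖ < RC → ‖Cf V Z‖ ≤ C₂ * ‖Z‖ ^ 2) (hCd : ∀ V, DifferentiableOn ℂ (Cf V) (ball 0 RC))
    (ιs : GaugeField P j SU2 → (𝒴 →L[ℂ] 𝒴')) (hι : ∀ V Y, ‖ιs V Y‖ ≤ ‖Y‖)
    (Hop : GaugeField P j SU2 → (𝒳 →L[ℂ] 𝒴)) (hH : ∀ V X, ‖Hop V X‖ ≤ B₀ * ‖X‖)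
    {ε₃ : ℝ} (h18 : 18 * C₂ * B₀ * ε₃ ≤ 1) (hcoup : ε₄ + B₀ * (2 * dL * C₁ * ε₁) ≤ ε₃) (h3R : 3 * ε₃ ≤ RC)
    (ℓs : ι → List (𝒴 →L[ℂ] Matrix n n ℂ)) {κr : ℝ} (hκ : 0 ≤ κr)
    (hℓ : ∀ p ∈ Pu, ∀ ℓ ∈ ℓs p, ∀ Y, ‖ℓ Y‖ ≤ κr * ‖Y‖) {m : ℕ} (hlen : ∀ p ∈ Pu, (ℓs p).length ≤ m)
    {κc : ℝ} (hκc : 0 ≤ κc) (hcurl : ∀ p ∈ Pu, ∀ Y, ‖((ℓs p).map fun ℓ => ℓ Y).sum‖ ≤ κc * ‖Y‖)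
    -- ══ (T2) THE WILSON SLOT'S SUPPLIER DATA AT THE READING OF RECORD (file 4
    -- `ShellMeasureLandauWilsonSquaresKernelsSchwarz.hE_landau_wilsonSquares_located_schwarz_of_decay`, per exterior section `V`,
    -- V-uniform constants): five FLAT pi-type chain spaces, ONE pin profile on a common position space (one-sided Lipschitz),
    -- the four linear letters as V-indexed DECAY KERNELS with reduced-rate row sums ((3.133)∕Thm 3.3, (46), (103) decay-halves
    -- TYPE — LOCATORS), the flat printed-TYPE lists, two localities with reaches, the block support of the coarse field, blind
    -- flat read-outs, the located count — NOTHING PINNED DISPLAYED; the Wilson budget LOCATED and SECOND ORDER (γ6) ══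
    {Λw Λz Λw' Λx Λb 𝔖 : Type*} [Fintype Λw] [DecidableEq Λw] [Fintype Λz] [Fintype Λw'] [Fintype Λx] [Fintype Λb]
    {𝔄w ℭ 𝔄' 𝔅 𝔇 : Type*} [NormedAddCommGroup 𝔄w] [NormedSpace ℂ 𝔄w] [CompleteSpace 𝔄w]
    [NormedAddCommGroup ℭ] [NormedSpace ℂ ℭ] [NormedAddCommGroup 𝔄'] [NormedSpace ℂ 𝔄']
    [NormedAddCommGroup 𝔅] [NormedSpace ℂ 𝔅] [CompleteSpace 𝔅] [NormedAddCommGroup 𝔇] [NormedSpace ℂ 𝔇]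
    {δw : ℝ} (hδw : 0 ≤ δw) (ϖw : 𝔖 → ℝ) (dis : 𝔖 → 𝔖 → ℝ) (hϖw : ∀ x y, ϖw x ≤ ϖw y + dis x y)
    (pos : Λw → 𝔖) (posz : Λz → 𝔖) (pos' : Λw' → 𝔖) (posx : Λx → 𝔖) (posb : Λb → 𝔖)
    (k𝒢 : GaugeField P j SU2 → Λw → Λz → (ℭ →L[ℂ] 𝔄w)) (kι : GaugeField P j SU2 → Λw' → Λw → (𝔄w →L[ℂ] 𝔄'))
    (kH : GaugeField P j SU2 → Λw → Λx → (𝔅 →L[ℂ] 𝔄w)) (kH₁ : GaugeField P j SU2 → Λw → Λb → (𝔇 →L[ℂ] 𝔄w))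
    {c𝒢 δ𝒢 M𝒢 cι δι Mι cH δH MH cH₁ δH₁ MH₁ : ℝ}
    (hc𝒢 : 0 ≤ c𝒢) (hM𝒢 : 0 ≤ M𝒢) (hk𝒢 : ∀ V c b', ‖k𝒢 V c b'‖ ≤ c𝒢 * Real.exp (-(δ𝒢 * dis (pos c) (posz b'))))
    (hM𝒢' : ∀ x, ∑ b', Real.exp (-((δ𝒢 - δw) * dis x (posz b'))) ≤ M𝒢)
    (hcι : 0 ≤ cι) (hMι : 0 ≤ Mι) (hkι : ∀ V c b', ‖kι V c b'‖ ≤ cι * Real.exp (-(δι * dis (pos' c) (pos b'))))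
    (hMι' : ∀ x, ∑ b', Real.exp (-((δι - δw) * dis x (pos b'))) ≤ Mι)
    (hcH : 0 ≤ cH) (hMH : 0 ≤ MH) (hkH : ∀ V c b', ‖kH V c b'‖ ≤ cH * Real.exp (-(δH * dis (pos c) (posx b'))))
    (hMH' : ∀ x, ∑ b', Real.exp (-((δH - δw) * dis x (posx b'))) ≤ MH)
    (hcH₁ : 0 ≤ cH₁) (hMH₁ : 0 ≤ MH₁) (hkH₁ : ∀ V c b', ‖kH₁ V c b'‖ ≤ cH₁ * Real.exp (-(δH₁ * dis (pos c) (posb b'))))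
    (hMH₁' : ∀ x, ∑ b', Real.exp (-((δH₁ - δw) * dis x (posb b'))) ≤ MH₁)
    -- the flat lists (P2)∕(P4)∕(118)∕(121)∕(103)∕(75)-TYPE∕(44) at radius `RCw` with `6(ε₄w + B₀w·bw) ≤ RCw`∕scaling∕(46)∕(54)
    (W𝒱w : GaugeField P j SU2 → (Λw → 𝔄w) → (Λz → ℭ)) {B₀w C₄w a₃w ε₄w bw : ℝ}
    (h𝒢w : ∀ V f, ‖kerOp (k𝒢 V) f‖ ≤ B₀w * ‖f‖) (hWw : ∀ V, Prop4Hyp (W𝒱w V) C₄w a₃w) (hB₀w : 0 < B₀w) (hC₄w : 0 ≤ C₄w)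
    (hε₄w : 0 ≤ ε₄w) (hdomw : 2 * (ε₄w + B₀w * bw) ≤ a₃w) (hselfw : B₀w * C₄w * (ε₄w + B₀w * bw) ^ 2 ≤ ε₄w)
    (hcontrw : 4 * B₀w * C₄w * (ε₄w + B₀w * bw) < 1) (hH₁w : ∀ V B, ‖kerOp (kH₁ V) B‖ ≤ B₀w * ‖B‖)
    (Φw : GaugeField P j SU2 → (Fin m₀ → ℂ) → (Λb → 𝔇)) {rΦw : ℝ} (hΦdw : ∀ V, DifferentiableOn ℂ (Φw V) (ball 0 rΦw))
    (hΦ0w : ∀ V, Φw V 0 = 0) (hΦbw : ∀ V, ∀ z ∈ ball (0 : Fin m₀ → ℂ) rΦw, ‖Φw V z‖ < bw) (h2Sw : 2 * S ≤ rΦw)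
    (Cw : GaugeField P j SU2 → (Λw' → 𝔄') → (Λx → 𝔅)) {C₂w RCw : ℝ} (hC₂w : 0 ≤ C₂w)
    (hCqw : ∀ V, ∀ Z : Λw' → 𝔄', ‖Z‖ < RCw → ‖Cw V Z‖ ≤ C₂w * ‖Z‖ ^ 2) (hCdw : ∀ V, DifferentiableOn ℂ (Cw V) (ball 0 RCw))
    (hιw : ∀ V Y, ‖kerOp (kι V) Y‖ ≤ ‖Y‖) (hHw : ∀ V X, ‖kerOp (kH V) X‖ ≤ B₀w * ‖X‖)
    (hqw : 9 * C₂w * B₀w * (ε₄w + B₀w * bw) < 1) (hRCw : 6 * (ε₄w + B₀w * bw) ≤ RCw)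
    -- localities with reaches, the block support, the two contraction numbers (DISPLAYED arithmetic on the decay constants)
    (NW : Λz → Λw → Prop)
    (hlocW : ∀ V, ∀ A A' : Λw → 𝔄w, ∀ c', (∀ b', NW c' b' → A b' = A' b') → W𝒱w V A c' = W𝒱w V A' c')
    {rW : ℝ} (hreachW : ∀ c' b', NW c' b' → ϖw (posz c') - rW ≤ ϖw (pos b'))
    (NC : Λx → Λw' → Prop)
    (hlocC : ∀ V, ∀ A A' : Λw' → 𝔄', ∀ c', (∀ b', NC c' b' → A b' = A' b') → Cw V A c' = Cw V A' c')
    {rC : ℝ} (hreachC : ∀ c' b', NC c' b' → ϖw (posx c') - rC ≤ ϖw (pos' b'))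
    (hsupp : ∀ V, ∀ z : Fin m₀ → ℂ, ∀ i, 0 < ϖw (posb i) → Φw V z i = 0)
    (hqW : c𝒢 * M𝒢 * (2 * C₄w * a₃w * Real.exp (δw * rW)) < 1)
    (hk : 2 * C₂w * RCw * Real.exp (δw * rC) * (cι * Mι) * (cH * MH) < 1)
    -- weight plaquettes; read-outs BLIND off located supports, FLAT op-norms, curl op-norm (DISPLAYED; `κ_c ∝ η²`), lengths
    {𝔭 : Type*} (Pw : Finset 𝔭) (ℓw : 𝔭 → List ((Λw → 𝔄w) →L[ℂ] Matrix n n ℂ)) (suppw : 𝔭 → Finset Λw)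
    (ϖPw : 𝔭 → ℝ)
    (hblindw : ∀ p ∈ Pw, ∀ ℓ ∈ ℓw p, ∀ A A' : Λw → 𝔄w, (∀ b' ∈ suppw p, A b' = A' b') → ℓ A = ℓ A')
    (hdepthw : ∀ p ∈ Pw, ∀ b' ∈ suppw p, ϖPw p ≤ ϖw (pos b')) (hϖPw : ∀ p ∈ Pw, 0 ≤ ϖPw p)
    {κwb κcb : ℝ} (hκwb : 0 ≤ κwb) (hκcb : 0 ≤ κcb) (hℓwb : ∀ p ∈ Pw, ∀ ℓ ∈ ℓw p, ‖ℓ‖ ≤ κwb)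
    (hcurlw : ∀ p ∈ Pw, ‖(ℓw p).sum‖ ≤ κcb)
    {mw : ℕ} (hlenw : ∀ p ∈ Pw, (ℓw p).length ≤ mw)
    -- the global tuple's real structure with SKEW weight read-outs
    (𝓡𝒴w : AddSubgroup (Λw → 𝔄w)) (h𝓡𝒴w : IsClosed (𝓡𝒴w : Set (Λw → 𝔄w))) (𝓡𝒵w : AddSubgroup (Λz → ℭ))
    (𝓡𝒴w' : AddSubgroup (Λw' → 𝔄')) (𝓡𝒳w : AddSubgroup (Λx → 𝔅)) (h𝓡𝒳w : IsClosed (𝓡𝒳w : Set (Λx → 𝔅)))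
    (𝓡ℬw : AddSubgroup (Λb → 𝔇))
    (h𝒢rw : ∀ V, ∀ f ∈ 𝓡𝒵w, kerOp (k𝒢 V) f ∈ 𝓡𝒴w) (hWrw : ∀ V, ∀ Y ∈ 𝓡𝒴w, W𝒱w V Y ∈ 𝓡𝒵w)
    (hιrw : ∀ V, ∀ Y ∈ 𝓡𝒴w, kerOp (kι V) Y ∈ 𝓡𝒴w') (hHrw : ∀ V, ∀ X ∈ 𝓡𝒳w, kerOp (kH V) X ∈ 𝓡𝒴w)
    (hCrw : ∀ V, ∀ Z ∈ 𝓡𝒴w', Cw V Z ∈ 𝓡𝒳w) (hH₁rw : ∀ V, ∀ B ∈ 𝓡ℬw, kerOp (kH₁ V) B ∈ 𝓡𝒴w)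
    (hΦrw : ∀ V, ∀ y : Fin m₀ → ℝ, ‖y‖ ≤ S → Φw V (cplx y) ∈ 𝓡ℬw)
    (hskew : ∀ p ∈ Pw, ∀ ℓ ∈ ℓw p, ∀ Y ∈ 𝓡𝒴w, ℓ Y ∈ skewAdjoint (Matrix n n ℂ))
    -- the frozen background plaquettes (N-ne7cp1-g31-2) with a uniform size bound, the located count, `0 ≤ β`
    (Bp : GaugeField P j SU2 → 𝔭 → Matrix n n ℂ) {d : 𝔭 → ℝ} {dbar : ℝ}
    (hBu : ∀ V, ∀ p ∈ Pw, Bp V p ∈ unitary (Matrix n n ℂ)) (hBd : ∀ V, ∀ p ∈ Pw, ‖Bp V p - 1‖ ≤ d p)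
    (hd : ∀ p ∈ Pw, d p ≤ dbar) (hdbar : 0 ≤ dbar)
    {Kw : ℝ} (hKw : ∑ p ∈ Pw, Real.exp (-(δw * ϖPw p)) ≤ Kw)
    -- ══ (T3) THE LOCATED NON-WILSON TERMS' SUPPLIER DATA (S71 f2 `hE_landau_chartRay_pinned`): the global tuple's PINNED
    -- INSTANCE `𝒴 := WSup (pinW δ′ ϖ) 1 𝔄`, located per-term functionals, pin depths, located sum `LK`, coupling ══
    {Λe : Type*} [Fintype Λe] {𝔄 : Type*} [NormedAddCommGroup 𝔄] [NormedSpace ℂ 𝔄] [CompleteSpace 𝔄] {δ' : ℝ} {ϖ : Λe → ℝ}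
    (hδ' : 0 ≤ δ') (hϖ : ∀ b', 0 ≤ ϖ b')
    {𝒴e' 𝒳e 𝒵e ℬe : Type*} [NormedAddCommGroup 𝒴e'] [NormedSpace ℂ 𝒴e'] [NormedAddCommGroup 𝒳e] [NormedSpace ℂ 𝒳e]
    [CompleteSpace 𝒳e] [NormedAddCommGroup 𝒵e] [NormedSpace ℂ 𝒵e] [NormedAddCommGroup ℬe] [NormedSpace ℂ ℬe]
    (𝒢e : GaugeField P j SU2 → (𝒵e →L[ℂ] WSup (pinW δ' ϖ) 1 𝔄)) (W𝒱e : GaugeField P j SU2 → WSup (pinW δ' ϖ) 1 𝔄 → 𝒵e)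
    {B₀e C₄e a₃e be ε₄e : ℝ}
    (h𝒢e : ∀ V f, ‖𝒢e V f‖ ≤ B₀e * ‖f‖) (hWe : ∀ V, Prop4Hyp (W𝒱e V) C₄e a₃e) (hB₀e : 0 < B₀e) (hC₄e : 0 ≤ C₄e)
    (hbe : 0 ≤ be) (hε₄e : 0 ≤ ε₄e) (hdome : 2 * (ε₄e + B₀e * be) ≤ a₃e)
    (hselfe : B₀e * C₄e * (ε₄e + B₀e * be) ^ 2 ≤ ε₄e) (hcontre : 4 * B₀e * C₄e * (ε₄e + B₀e * be) < 1)
    (H₁e : GaugeField P j SU2 → (ℬe →L[ℂ] WSup (pinW δ' ϖ) 1 𝔄)) (hH₁e : ∀ V B, ‖H₁e V B‖ ≤ B₀e * ‖B‖)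
    (Φe : GaugeField P j SU2 → (Fin m₀ → ℂ) → ℬe) {rΦe : ℝ} (hΦde : ∀ V, DifferentiableOn ℂ (Φe V) (ball 0 rΦe))
    (hΦ0e : ∀ V, Φe V 0 = 0) (hΦbe : ∀ V, ∀ z ∈ ball (0 : Fin m₀ → ℂ) rΦe, ‖Φe V z‖ < be) (hSre : S < rΦe)
    (Ce : GaugeField P j SU2 → 𝒴e' → 𝒳e) {C₂e RCe : ℝ} (hC₂e : 0 ≤ C₂e)
    (hCqe : ∀ V, ∀ Z : 𝒴e', ‖Z‖ < RCe → ‖Ce V Z‖ ≤ C₂e * ‖Z‖ ^ 2) (hCde : ∀ V, DifferentiableOn ℂ (Ce V) (ball 0 RCe))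
    (ιe : GaugeField P j SU2 → (WSup (pinW δ' ϖ) 1 𝔄 →L[ℂ] 𝒴e')) (hιe : ∀ V Y, ‖ιe V Y‖ ≤ ‖Y‖)
    (He : GaugeField P j SU2 → (𝒳e →L[ℂ] WSup (pinW δ' ϖ) 1 𝔄)) (hHe : ∀ V X, ‖He V X‖ ≤ B₀e * ‖X‖)
    (hqe : 9 * C₂e * B₀e * (ε₄e + B₀e * be) < 1) (hRCe : 3 * (ε₄e + B₀e * be) ≤ RCe)
    {𝔱 : Type*} (I : Finset 𝔱) {Ef : 𝔱 → (Λe → 𝔄) → ℂ} {rE : ℝ} {ee : 𝔱 → ℝ} (hrE : 0 < rE)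
    (hEd : ∀ i ∈ I, DifferentiableOn ℂ (Ef i) (ball 0 rE))
    (hEb : ∀ i ∈ I, ∀ Z ∈ ball (0 : Λe → 𝔄) rE, ‖Ef i Z‖ ≤ ee i) (he0 : ∀ i ∈ I, 0 ≤ ee i)
    (supp : 𝔱 → Finset Λe) (hblind : ∀ i ∈ I, ∀ A₁ A₂ : Λe → 𝔄, (∀ b' ∈ supp i, A₁ b' = A₂ b') → Ef i A₁ = Ef i A₂)
    (ϖP : 𝔱 → ℝ) (hdepth : ∀ i ∈ I, ∀ b' ∈ supp i, ϖP i ≤ ϖ b')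
    {LK : ℝ} (hLK : 0 ≤ LK) (hK : ∑ i ∈ I, 2 * ee i / rE * Real.exp (-(δ' * ϖP i)) ≤ LK)
    (hcoupE : ((ε₄e + B₀e * be) + B₀e * (4 * C₂e * (ε₄e + B₀e * be) ^ 2)) ≤ rE / 2)
    {BE₁ : ℝ} (hElb₁ : ∀ V (y : Fin m₀ → ℝ), ‖y‖ ≤ S → -BE₁ ≤
      (∑ i ∈ I, Ef i (WSup.toPiL (𝔄 := 𝔄) (pinW δ' ϖ) 1
        (landauExp (Ce V) (ιe V) (He V) (4 * C₂e * (ε₄e + B₀e * be) ^ 2)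
          (solAt (𝒢e V) 0 (W𝒱e V) ε₄e (0 : 𝒵e) (H₁e V (Φe V (cplx y))) + H₁e V (Φe V (cplx y)))))).re)
    -- ══ (S78) THE FLUCTUATION-DRESSED TERMS: `−log ∫ g e^{A} dμ` with an ω-UNIFORM ray constant `B_d`, integrability and
    -- positivity of the dressed integral, a lower bound on the S-ball (all DISPLAYED) ══
    {Ω : Type*} [MeasurableSpace Ω] (μ : Measure Ω) {g : Ω → ℝ} (hg : ∀ ω, 0 ≤ g ω)
    (A : GaugeField P j SU2 → (Fin m₀ → ℝ) → Ω → ℝ) {Bd : ℝ} (hBd0 : 0 ≤ Bd)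
    (hint : ∀ V, ∀ x ∈ W V, ∀ c : ℝ, 1 / 2 ≤ c → c ≤ 1 → Integrable (fun ω => g ω * Real.exp (A V (c • x) ω)) μ)
    (hpos : ∀ V, ∀ x ∈ W V, ∀ c : ℝ, 1 / 2 ≤ c → c ≤ 1 → 0 < ∫ ω, g ω * Real.exp (A V (c • x) ω) ∂μ)
    (hA : ∀ V, ∀ x ∈ W V, ∀ c : ℝ, 1 / 2 ≤ c → c ≤ 1 → ∀ ω, A V x ω ≤ A V (c • x) ω + (1 - c) * Bd)
    {BE₂ : ℝ} (hElb₂ : ∀ V (y : Fin m₀ → ℝ), ‖y‖ ≤ S → -BE₂ ≤ (-Real.log (∫ ω, g ω * Real.exp (A V y ω) ∂μ)))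
    (L : Set (𝒴 →L[ℂ] Matrix n n ℂ))
    (𝓡𝒵 : AddSubgroup 𝒵) (𝓡𝒴' : AddSubgroup 𝒴') (𝓡𝒳 : AddSubgroup 𝒳) (h𝓡𝒳 : IsClosed (𝓡𝒳 : Set 𝒳))
    (𝓡ℬ : AddSubgroup ℬ)
    (h𝒢r : ∀ V, ∀ f ∈ 𝓡𝒵, 𝒢 V f ∈ readOutReal L) (hWr : ∀ V, ∀ Y ∈ readOutReal L, W𝒱 V Y ∈ 𝓡𝒵)
    (hιr : ∀ V, ∀ Y ∈ readOutReal L, ιs V Y ∈ 𝓡𝒴') (hHr : ∀ V, ∀ X ∈ 𝓡𝒳, Hop V X ∈ readOutReal L)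
    (hCr : ∀ V, ∀ Z ∈ 𝓡𝒴', Cf V Z ∈ 𝓡𝒳) (hH₁r : ∀ V, ∀ B ∈ 𝓡ℬ, H₁ V B ∈ readOutReal L)
    (hΦr : ∀ V, ∀ y : Fin m₀ → ℝ, ‖y‖ ≤ S → Φ V (cplx y) ∈ 𝓡ℬ)
    (hRdict : ∀ V, ∀ x ∈ cube m₀ S,
      F (fixTo (combBonds lo hi) 1 (updateFinset V Λ (expFibreChart Λ 1 e x))) =
        Jco V x * ENNReal.ofReal (Real.exp (-((∑ p ∈ Pw, β * (1 - (Matrix.trace (Bp V p * holOf (ℓw p)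
            (fun y => landauExp (Cw V) (kerOp (kι V)) (kerOp (kH V)) (4 * C₂w * (ε₄w + B₀w * bw) ^ 2)
              (solAt (kerOp (k𝒢 V)) 0 (W𝒱w V) ε₄w (0 : Λz → ℭ) (kerOp (kH₁ V) (Φw V (cplx y))) +
                kerOp (kH₁ V) (Φw V (cplx y)))) x)).re /
            Fintype.card n)) +
          ((∑ i ∈ I, Ef i (WSup.toPiL (𝔄 := 𝔄) (pinW δ' ϖ) 1
            (landauExp (Ce V) (ιe V) (He V) (4 * C₂e * (ε₄e + B₀e * be) ^ 2)
              (solAt (𝒢e V) 0 (W𝒱e V) ε₄e (0 : 𝒵e) (H₁e V (Φe V (cplx x))) + H₁e V (Φe V (cplx x)))))).re +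
          (-Real.log (∫ ω, g ω * Real.exp (A V x ω) ∂μ)))))))
    (hudict : ∀ V, ∀ x ∈ cube m₀ S,
      u (fixTo (combBonds lo hi) 1 (updateFinset V Λ (expFibreChart Λ 1 e x))) =
        classifier hPu (fun p => holOf (ℓs p) (fun y => landauExp (Cf V) (ιs V) (Hop V)
          (4 * C₂ * (ε₄ + B₀ * (2 * dL * C₁ * ε₁)) ^ 2)
          (solAt (𝒢 V) 0 (W𝒱 V) ε₄ (0 : 𝒵) (H₁ V (Φ V (cplx y))) + H₁ V (Φ V (cplx y))))) x)
    (hJW : ∀ V x, Jco V x ≠ 0 → x ∈ W V)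
    (hJ : ∀ V x, ∀ a : ℝ, 0 ≤ a → Jco V x ≤ Jco V (Real.exp (-a) • x))
    (hJ1 : ∀ V x, Jco V x ≤ 1)
    (hWS : ∀ V, W V ⊆ closedBall (0 : Fin m₀ → ℝ) S)
    (hδ0 : 0 ≤ δ) (hδ1 : δ < 1) (hρ0 : 0 ≤ ρ) (hρ : ρ ≤ (1 - δ) / 2) (hβ : 0 ≤ β)
    -- SM-L2 (SM) DISCHARGED IN THE STOKES CURRENCY (S73 `hSM_of_stokes`): the η-scalings of the classifier's read-out data
    -- DISPLAYED — curl read-out × field size `κ_c·z̄ ≤ c₁η²z` (B11 (25)∕(37) TYPE), letter size `κ_r·z̄ ≤ c₂ηz` ((19) TYPE),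
    -- regime `m·κ_r·z̄ ≤ 1` — the UNIT-currency smallness `36(c₁z + m²c₂²z²)∕(r_Φ∕S − 1)² ≤ δ·εθ`, and the classifier
    -- threshold `θ := εθ·η²` (B14 (2.17) TYPE): the `η²` CANCELS
    {η εθ c₁ c₂ z : ℝ} (hη : 0 < η) (hεθ : 0 < εθ)
    (hs₁ : κc * ((ε₄ + B₀ * (2 * dL * C₁ * ε₁)) + B₀ * (4 * C₂ * (ε₄ + B₀ * (2 * dL * C₁ * ε₁)) ^ 2)) ≤ c₁ * η ^ 2 * z)
    (ha : κr * ((ε₄ + B₀ * (2 * dL * C₁ * ε₁)) + B₀ * (4 * C₂ * (ε₄ + B₀ * (2 * dL * C₁ * ε₁)) ^ 2)) ≤ c₂ * η * z)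
    (hma : m * (κr * ((ε₄ + B₀ * (2 * dL * C₁ * ε₁)) + B₀ * (4 * C₂ * (ε₄ + B₀ * (2 * dL * C₁ * ε₁)) ^ 2))) ≤ 1)
    (hsm : 36 * (c₁ * z + m ^ 2 * c₂ ^ 2 * z ^ 2) / (rΦ / S - 1) ^ 2 ≤ δ * εθ)
    -- THE DISPLAYED γ3 INPUT OF RECORD (N-ne7cp1-g32-2 ∕ N-ne7cp1-g33-2 «COLLAR»; leaf-01-g8 l.18489, leaf-08-g14 l.18568):
    -- radius `(d−1)·nb·a ≤ 2 sin(S∕2)`, a cover of the box plaquettes by a CORE set (⊇ the plaquettes of `□^∼`) and a COLLAR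
    -- set, and the PAIR of readings — «sub-threshold ⟹ core plaquettes `a`-small» (B14 (2.16)–(2.17) + average regularity
    -- [Balaban1985Averaging] Props 1∕2 TYPE, from `u < θ`) and «`F ≠ 0` ⟹ collar plaquettes `a`-small» (the density's KEPT
    -- co-tests, B15 (1.3)–(1.9) TYPE — a SUPPORT property); located, NOT asserted — REPLACE `hreach′` of file 1 (hence
    -- `hFsupp` of S80 f3); binder NAMES = S87 f4's (`hn hN hΛbox hΛcomb ha0 hrad hcover hcore hcollar`; the two plaquette
    -- sets are called `Pcore`∕`Pcollar` here because S80 f3 already uses `A` for the (S78) dressed action)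
    {a : ℝ} (ha0 : 0 ≤ a) (hrad : ((P.d - 1 : ℕ) : ℝ) * nb * a ≤ 2 * Real.sin (S / 2))
    {Pcore Pcollar : Set (Plaq P j)} (hcover : boxPlaqs lo hi ⊆ Pcore ∪ Pcollar)
    (hcore : ∀ (V : GaugeField P j SU2) (y : ↥Λ → SU2),
      u (fixTo (combBonds lo hi) 1 (updateFinset V Λ y)) < εθ * η ^ 2 →
        PlaqSmallOn Pcore a (fixTo (combBonds lo hi) 1 (updateFinset V Λ y)))
    (hcollar : ∀ (V : GaugeField P j SU2) (y : ↥Λ → SU2),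
      F (fixTo (combBonds lo hi) 1 (updateFinset V Λ y)) ≠ 0 →
        PlaqSmallOn Pcollar a (fixTo (combBonds lo hi) 1 (updateFinset V Λ y))) :
    SlotAntiConcentration ((fieldMeasure P j SU2).withDensity ({U | u U < εθ * η ^ 2}.indicator F)) u (εθ * η ^ 2) ρ
      (2 * ((m₀ : ℝ) + (3 * (|β| * ((dbar +
          2 * (κcb * (cH₁ * MH₁ * bw / ((1 - c𝒢 * M𝒢 * (2 * C₄w * a₃w * Real.exp (δw * rW))) *
              (1 - 2 * C₂w * RCw * Real.exp (δw * rC) * (cι * Mι) * (cH * MH)))) +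
            expTail₂ (mw * (κwb * (cH₁ * MH₁ * bw / ((1 - c𝒢 * M𝒢 * (2 * C₄w * a₃w * Real.exp (δw * rW))) *
              (1 - 2 * C₂w * RCw * Real.exp (δw * rC) * (cι * Mι) * (cH * MH))))))) / (rΦw / S)) *
          (2 * (κcb * (cH₁ * MH₁ * bw / ((1 - c𝒢 * M𝒢 * (2 * C₄w * a₃w * Real.exp (δw * rW))) *
              (1 - 2 * C₂w * RCw * Real.exp (δw * rC) * (cι * Mι) * (cH * MH)))) +
            expTail₂ (mw * (κwb * (cH₁ * MH₁ * bw / ((1 - c𝒢 * M𝒢 * (2 * C₄w * a₃w * Real.exp (δw * rW))) *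
              (1 - 2 * C₂w * RCw * Real.exp (δw * rC) * (cι * Mι) * (cH * MH))))))) / (rΦw / S))) * Kw) +
        (3 * (LK * (2 * ((ε₄e + B₀e * be) + B₀e * (4 * C₂e * (ε₄e + B₀e * be) ^ 2)))) / (rΦe / S - 1) + Bd))) / (1 - δ)) := by
  -- numbers: the chart radius in window units, the threshold, (SM) in the Stokes currency (S73), the scheme numerics
  have hRad1 : 1 < rΦ / S := by rw [lt_div_iff₀ hS]; linarith
  have hθ : 0 < εθ * η ^ 2 := by positivity
  have hκz : 0 ≤ κr * ((ε₄ + B₀ * (2 * dL * C₁ * ε₁)) + B₀ * (4 * C₂ * (ε₄ + B₀ * (2 * dL * C₁ * ε₁)) ^ 2)) := by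
    positivity
  have hSM := hSM_of_stokes (δ := δ) hRad1 hη hκz hs₁ ha hma hsm
  obtain ⟨hdom, hself, hcontr, -⟩ := scheme_numbers_of_printed hdL hB₀.le hC₁ hC₄ hε₁ hε₄ hB₃ h1 h2 h3
  have hself' : B₀ * C₄ * (ε₄ + B₀ * (2 * dL * C₁ * ε₁)) ^ 2 ≤ ε₄ := by simpa using hself
  have hcontr' : 4 * B₀ * C₄ * (ε₄ + B₀ * (2 * dL * C₁ * ε₁)) < 1 := by simpa using hcontr
  obtain ⟨hq, hRC⟩ := sectC_numbers_of_printed hC₂ hB₀.le h18 hcoup h3R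
  have hWc : ∀ V, ∀ x ∈ W V, x ∈ cube m₀ S := fun V x hx => mem_cube_of_mem_closedBall (hWS V hx)
  -- S80 f6 BY NAME for the RESTRICTED density with the indicator-multiplied co-test
  exact slotAC_realized_su2_landauChart_assembled_decay_of_core_collar hn hN Λ hΛbox hΛcomb e hS hSπ
    (F := {U | u U < εθ * η ^ 2}.indicator F) (measurable_indicator_density hu _ hF)
    (fun g U => indicator_mul_invariant (fun U' => hui g U') (fun U' => hFi g U') U) hu hui hPu W
    (fun V x => {x' | u (fixTo (combBonds lo hi) 1 (updateFinset V Λ (expFibreChart Λ 1 e x'))) < εθ * η ^ 2}.indicator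
      (Jco V) x)
    𝒢 W𝒱 h𝒢 hW hB₀ hC₄ hε₄ hdL hC₁ hε₁ hB₃ h1 h2 h3 H₁ hH₁ Φ hΦd hΦ0 hΦ hSr Cf hC₂ hCq hCd ιs hι Hop hH h18 hcoup h3R
    ℓs hκ hℓ hlen hκc hcurl hδw ϖw dis hϖw pos posz pos' posx posb k𝒢 kι kH kH₁ hc𝒢 hM𝒢 hk𝒢 hM𝒢' hcι hMι hkι hMι' hcH
    hMH hkH hMH' hcH₁ hMH₁ hkH₁ hMH₁' W𝒱w h𝒢w hWw hB₀w hC₄w hε₄w hdomw hselfw hcontrw hH₁w Φw hΦdw hΦ0w hΦbw h2Sw Cw hC₂w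
    hCqw hCdw hιw hHw hqw hRCw NW hlocW hreachW NC hlocC hreachC hsupp hqW hk Pw ℓw suppw ϖPw hblindw hdepthw hϖPw hκwb
    hκcb hℓwb hcurlw hlenw 𝓡𝒴w h𝓡𝒴w 𝓡𝒵w 𝓡𝒴w' 𝓡𝒳w h𝓡𝒳w 𝓡ℬw h𝒢rw hWrw hιrw hHrw hCrw hH₁rw hΦrw hskew Bp hBu hBd hd
    hdbar hKw hδ' hϖ 𝒢e W𝒱e h𝒢e hWe hB₀e hC₄e hbe hε₄e hdome hselfe hcontre H₁e hH₁e Φe hΦde hΦ0e hΦbe hSre Ce hC₂e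
    hCqe hCde ιe hιe He hHe hqe hRCe I hrE hEd hEb he0 supp hblind ϖP hdepth hLK hK hcoupE hElb₁ μ hg A hBd0 hint hpos
    hA hElb₂ L 𝓡𝒵 𝓡𝒴' 𝓡𝒳 h𝓡𝒳 𝓡ℬ h𝒢r hWr hιr hHr hCr hH₁r hΦr
    (fun V x hx => by
      -- the restricted density's sections against `hRdict`, by cases on the indicator
      by_cases hlt : u (fixTo (combBonds lo hi) 1 (updateFinset V Λ (expFibreChart Λ 1 e x))) < εθ * η ^ 2
      · rw [indicator_of_mem (show fixTo (combBonds lo hi) 1 (updateFinset V Λ (expFibreChart Λ 1 e x)) ∈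
            {U | u U < εθ * η ^ 2} from hlt),
          indicator_of_mem (show x ∈ {x' | u (fixTo (combBonds lo hi) 1 (updateFinset V Λ (expFibreChart Λ 1 e x'))) <
            εθ * η ^ 2} from hlt), hRdict V x hx]
      · rw [indicator_of_notMem (show fixTo (combBonds lo hi) 1 (updateFinset V Λ (expFibreChart Λ 1 e x)) ∉
            {U | u U < εθ * η ^ 2} from hlt),
          indicator_of_notMem (show x ∉ {x' | u (fixTo (combBonds lo hi) 1 (updateFinset V Λ (expFibreChart Λ 1 e x'))) <
            εθ * η ^ 2} from hlt), zero_mul])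
    hudict
    (fun V x hne => hJW V x fun h0 => hne (le_antisymm ((indicator_le_self _ _ x).trans_eq h0) bot_le))
    (fun V x a ha' => by
      -- CENTRE-MONOTONICITY of the extra indicator: the sub-threshold set is star-shaped along the contraction (S87 f2 §2)
      by_cases hJx : Jco V x = 0
      · have h0 : {x' | u (fixTo (combBonds lo hi) 1 (updateFinset V Λ (expFibreChart Λ 1 e x'))) < εθ * η ^ 2}.indicator
            (Jco V) x = 0 := le_antisymm ((indicator_le_self _ _ x).trans_eq hJx) bot_le
        rw [h0]; exact bot_le
      by_cases hlt : u (fixTo (combBonds lo hi) 1 (updateFinset V Λ (expFibreChart Λ 1 e x))) < εθ * η ^ 2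
      · have hxW : x ∈ W V := hJW V x hJx
        have hxc : x ∈ cube m₀ S := hWc V x hxW
        have hxc' : Real.exp (-a) • x ∈ cube m₀ S :=
          mem_cube_of_mem_closedBall (exp_neg_smul_mem_closedBall (hWS V hxW) ha')
        have hc1 : Real.exp (-a) ≤ 1 := by rw [Real.exp_le_one_iff]; linarith
        have hlt1 := hlt
        rw [hudict V x hxc] at hlt1
        have hlt2 := classifier_lt_of_contraction hPu _ hRad1 hθ hδ0 hδ1.le hSM
          (hAN_landau_chartRay_stokes hS (hWS V) (h𝒢 V) (hW V) hB₀ hC₄ hε₄ hdom hself' hcontr' (H₁ V) (hH₁ V)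
            (hΦd V) (hΦ0 V) (hΦ V) hSr hC₂ (hCq V) (hCd V) (ιs V) (hι V) (Hop V) (hH V) hq hRC ℓs hκ hℓ hκc hcurl
            hlen x hxW)
          hlt1 (Real.exp_pos (-a)) hc1
        rw [← hudict V (Real.exp (-a) • x) hxc'] at hlt2
        rw [indicator_of_mem (show x ∈ {x' | u (fixTo (combBonds lo hi) 1 (updateFinset V Λ (expFibreChart Λ 1 e x'))) <
            εθ * η ^ 2} from hlt),
          indicator_of_mem (show Real.exp (-a) • x ∈ {x' | u (fixTo (combBonds lo hi) 1 (updateFinset V Λ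
            (expFibreChart Λ 1 e x'))) < εθ * η ^ 2} from hlt2)]
        exact hJ V x a ha'
      · rw [indicator_of_notMem (show x ∉ {x' | u (fixTo (combBonds lo hi) 1 (updateFinset V Λ (expFibreChart Λ 1 e x'))) <
            εθ * η ^ 2} from hlt)]
        exact bot_le)
    (fun V x => (indicator_le_self _ _ x).trans (hJ1 V x))
    hWS hδ0 hδ1 hρ0 hρ hβ hη hεθ hs₁ ha hma hsm ha0 hrad hcover hcore
    (fun V y hne => hcollar V y fun hF0 => hne (by
      by_cases hlt : u (fixTo (combBonds lo hi) 1 (updateFinset V Λ y)) < εθ * η ^ 2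
      · rw [indicator_of_mem (show fixTo (combBonds lo hi) 1 (updateFinset V Λ y) ∈ {U | u U < εθ * η ^ 2} from hlt), hF0]
      · exact indicator_of_notMem (show fixTo (combBonds lo hi) 1 (updateFinset V Λ y) ∉ {U | u U < εθ * η ^ 2} from hlt)
          F))

end Kept

end Summit.QuantumFields.BalabanUV.T4Continuum.ShellMeasureLandauEndAssembledDecayReachBoxKept

end
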